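import Literature.Probability.RandomPlanarGeometry.HexParafermion
import Literature.Probability.RandomPlanarGeometry.HexSAW
import HarnessLib

/-!
# Crux `SAWDevelopingMap.ObservableToSLE` (stmt-CriticalPhenomena-10472), line
`floor-ratio-restriction-bootstrap`: the dictionary for `stub_canonicalTransfer`, pendant sandwich

Landing target:
`Summits/CriticalPhenomena/SAWScalingLimit/Theorems/SAWDevelopingMapObservableToSLECanonicalTransferPendantSandwich.lean`
(`--supports stmt-CriticalPhenomena-10472`).  Sequel of `…CanonicalTransferDictionary.lean`
(whose walk-space bijections are repeated here as private local copies, to keep this file's imports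
in `Literature`).

At the mesh parameters `δ` with `frac(2h/(√3 δ)) ∈ [1/3, 2/3)` the canonical domain `Ω_δ` of a
floor domain (floor `Im = h`) has a ONE-SIDED lowest row of PENDANT vertices, and the canonical
endpoints of `stub_canonicalTransfer` are pendant: the canonical walks `a → b` are
`a → a' ⇝ b' → b` with two forced end-steps.  This file proves the pendant-endpoint versions of
the walk-space comparisons:

* `exists_equiv_isPath_pendant`, `mem_of_mem_support_isPath` — stripping pendant endpoints is a
  bijection `{a → b} ≃ {a' ⇝ b' avoiding a, b}` (vertex count shifted by `2`), and self-avoiding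
  walks meet degree-`≤ 1` vertices only at their endpoints (any simple graph);
* `sum_pow_vertexCount_le_pendant` (outer bound `Z^{can}(a,b) ≤ x² Z_V({a',a},{b',b})`),
  `pendant_sum_pow_length_le` (inner bound `x² Z_Λ({a',a},{b',b}) ≤ Z^{can}(a,b)`);
* `stub_canonicalTransfer_pendantSandwich` — the registered sub-goal: both bounds.
-/

noncomputable section

open scoped BigOperators Classical ENNReal
open MeasureTheory
open Literature.Probability.LatticeModels (HexVertex hexGraph hexCenter)
open Literature.Probability.RandomPlanarGeometry
open Literature.Probability.RandomPlanarGeometry.SAW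

namespace Summit.CriticalPhenomena.SAWScalingLimit.Theorems.ObservableToSLE.FloorRatio

/-! ### Local copies of the dictionary bijections -/

section LocalCopies

variable {Λ : Finset HexVertex} {va ua vb ub : HexVertex}

/-- Local copy of `eq_of_mem_sym2_of_mem` (`…CanonicalTransferDictionary.lean`), kept private. [folklore] -/
private theorem eq_of_mem_sym2_of_mem_loc {v u w : HexVertex} (hu : u ∉ Λ) (hw : w ∈ Λ)
    (h : w ∈ s(v, u)) : w = v := by
  rcases Sym2.mem_iff.1 h with rfl | rfl
  · rfl
  · exact absurd hw hu

/-- Local copy of `exists_equiv_isPath_hexMidEdgeSAW` (`…CanonicalTransferDictionary.lean`), kept private. [folklore] -/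
private theorem exists_equiv_isPath_hexMidEdgeSAW_loc (hva : va ∈ Λ) (hua : ua ∉ Λ) (hub : ub ∉ Λ)
    (ha : hexGraph.Adj va ua) (hne : s(va, ua) ≠ s(vb, ub)) :
    ∃ e : {p : hexGraph.Walk va vb // p.IsPath ∧ ∀ w ∈ p.support, w ∈ Λ} ≃
        HexMidEdgeSAW Λ s(va, ua) s(vb, ub), ∀ p, (e p).verts = p.1.support := by
  -- the forward map: a path is the mid-edge walk with the same vertex list
  let F : {p : hexGraph.Walk va vb // p.IsPath ∧ ∀ w ∈ p.support, w ∈ Λ} →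
      HexMidEdgeSAW Λ s(va, ua) s(vb, ub) := fun p =>
    { verts := p.1.support
      subset := p.2.2
      nodup := p.2.1.support_nodup
      isChain := p.1.isChain_adj_support
      head_mem := fun v hv => by
        rw [List.head?_eq_some_iff] at hv
        obtain ⟨l, hl⟩ := hv
        have : p.1.support.head p.1.support_ne_nil = v := by simp [hl]
        rw [SimpleGraph.Walk.head_support] at this
        exact this ▸ Sym2.mem_mk_left _ _
      getLast_mem := fun v hv => by
        rw [List.getLast?_eq_some_getLast p.1.support_ne_nil, Option.some_inj,
          SimpleGraph.Walk.getLast_support] at hv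
        exact hv ▸ Sym2.mem_mk_left _ _
      eq_of_nil := fun h => absurd h p.1.support_ne_nil
      edges_nodup := fun _ => by
        rw [← SimpleGraph.Walk.edges_eq_zipWith_support, List.cons_append, List.nodup_cons,
          List.mem_append, List.mem_singleton, not_or]
        refine ⟨⟨fun h => hua (p.2.2 _ (p.1.snd_mem_support_of_mem_edges h)), hne⟩, ?_⟩
        rw [List.nodup_append]
        refine ⟨p.2.1.isTrail.edges_nodup, List.nodup_singleton _, ?_⟩
        rintro e he _ h rfl
        rw [List.mem_singleton] at h
        subst h
        exact hub (p.2.2 _ (p.1.snd_mem_support_of_mem_edges he))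
      fst_mem := ⟨(SimpleGraph.mem_edgeSet hexGraph).2 ha, va, Sym2.mem_mk_left _ _, hva⟩ }
  have hF : ∀ p, (F p).verts = p.1.support := fun _ => rfl
  have hinj : Function.Injective F := fun p q h =>
    Subtype.ext (SimpleGraph.Walk.ext_support (by rw [← hF, ← hF, h]))
  have hsurj : Function.Surjective F := by
    intro γ
    have hne' : γ.verts ≠ [] := fun h => hne (γ.eq_of_nil h)
    have hhead : γ.verts.head hne' = va :=
      eq_of_mem_sym2_of_mem_loc hua (γ.subset _ (List.head_mem hne'))
        (γ.head_mem _ (List.head?_eq_some_head hne'))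
    have hlast : γ.verts.getLast hne' = vb :=
      eq_of_mem_sym2_of_mem_loc hub (γ.subset _ (List.getLast_mem hne'))
        (γ.getLast_mem _ (List.getLast?_eq_some_getLast hne'))
    let p : hexGraph.Walk va vb :=
      (SimpleGraph.Walk.ofSupport γ.verts hne' γ.isChain).copy hhead hlast
    have hp : p.support = γ.verts := by
      simp only [p, SimpleGraph.Walk.support_copy, SimpleGraph.Walk.support_ofSupport]
    refine ⟨⟨p, (SimpleGraph.Walk.isPath_def p).2 (hp ▸ γ.nodup), fun w hw => γ.subset w (hp ▸ hw)⟩,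
      HexMidEdgeSAW.ext ?_⟩
    rw [hF, hp]
  exact ⟨Equiv.ofBijective F ⟨hinj, hsurj⟩, fun p => hF p⟩


variable {V : Type*} {G G' : SimpleGraph V}

/-- Local copy of `exists_equiv_isPath_of_le` (`…CanonicalTransferDictionary.lean`), kept private. [folklore] -/
private theorem exists_equiv_isPath_of_le_loc (hle : G' ≤ G) {Λ : Set V}
    (hΛ : ∀ v ∈ Λ, ∀ w ∈ Λ, G.Adj v w → G'.Adj v w) (u v : V) :
    ∃ e : {p : G'.Walk u v // p.IsPath ∧ ∀ w ∈ p.support, w ∈ Λ} ≃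
        {p : G.Walk u v // p.IsPath ∧ ∀ w ∈ p.support, w ∈ Λ},
      ∀ p, (e p).1.support = p.1.support := by
  have hedges : ∀ p : {p : G.Walk u v // p.IsPath ∧ ∀ w ∈ p.support, w ∈ Λ},
      ∀ e ∈ p.1.edges, e ∈ G'.edgeSet := by
    rintro p e he
    induction e using Sym2.ind with
    | h x y =>
      exact hΛ x (p.2.2 _ (p.1.fst_mem_support_of_mem_edges he)) y
        (p.2.2 _ (p.1.snd_mem_support_of_mem_edges he)) (p.1.adj_of_mem_edges he)
  refine ⟨{ toFun := fun p => ⟨p.1.mapLe hle, (SimpleGraph.Walk.isPath_mapLe hle).2 p.2.1,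
              fun w hw => p.2.2 w ?_⟩
            invFun := fun p => ⟨p.1.transfer G' (hedges p), p.2.1.transfer _,
              fun w hw => p.2.2 w ?_⟩
            left_inv := fun p => Subtype.ext (SimpleGraph.Walk.ext_support ?_)
            right_inv := fun p => Subtype.ext (SimpleGraph.Walk.ext_support ?_) },
    fun p => SimpleGraph.Walk.support_mapLe_eq_support hle p.1⟩
  · rwa [SimpleGraph.Walk.support_mapLe_eq_support] at hw
  · rwa [SimpleGraph.Walk.support_transfer] at hw
  · rw [SimpleGraph.Walk.support_transfer, SimpleGraph.Walk.support_mapLe_eq_support]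
  · rw [SimpleGraph.Walk.support_mapLe_eq_support, SimpleGraph.Walk.support_transfer]

end LocalCopies

/-! ### Stripping pendant endpoints -/

section Pendant

variable {V : Type*} {G : SimpleGraph V} {a b a' b' : V}

/-- **Pendant endpoints.**  If the endpoints `a ≠ b` of the walks have unique neighbours `a'`,
`b'` in `G` (pendant vertices, e.g. the one-sided lowest row of the canonical domain `Ω_δ` of a
floor domain) and `a' ≠ b`, then the self-avoiding walks `a → b` are exactly
`a → a' ⇝ b' → b` with `a' ⇝ b'` a self-avoiding walk avoiding `a` and `b`: stripping the two
forced end-steps is a bijection (it shifts the number of vertices by `2`). [folklore] -/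
theorem exists_equiv_isPath_pendant (hab : a ≠ b) (ha : ∀ w, G.Adj a w ↔ w = a')
    (hb : ∀ w, G.Adj b w ↔ w = b') (ha'b : a' ≠ b) :
    ∃ e : {p : G.Walk a b // p.IsPath} ≃
        {q : G.Walk a' b' // q.IsPath ∧ a ∉ q.support ∧ b ∉ q.support},
      ∀ p, p.1.support = a :: ((e p).1.support ++ [b]) := by
  have haa' : G.Adj a a' := (ha a').2 rfl
  have hbb' : G.Adj b' b := ((hb b').2 rfl).symm
  -- backward map
  let B : {q : G.Walk a' b' // q.IsPath ∧ a ∉ q.support ∧ b ∉ q.support} →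
      {p : G.Walk a b // p.IsPath} := fun q =>
    ⟨SimpleGraph.Walk.cons haa' (q.1.concat hbb'), by
      refine SimpleGraph.Walk.IsPath.cons (q.2.1.concat q.2.2.2 hbb') ?_
      rw [SimpleGraph.Walk.support_concat, List.mem_append, List.mem_singleton, not_or]
      exact ⟨q.2.2.1, hab⟩⟩
  have hB : ∀ q, (B q).1.support = a :: (q.1.support ++ [b]) := fun q => by
    simp [B, SimpleGraph.Walk.support_concat]
  have hinj : Function.Injective B := by
    intro q q' h
    have h' := congrArg (fun p : {p : G.Walk a b // p.IsPath} => p.1.support) h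
    simp only [hB, List.cons.injEq, true_and] at h'
    exact Subtype.ext (SimpleGraph.Walk.ext_support (List.append_cancel_right h'))
  have hsurj : Function.Surjective B := by
    rintro ⟨p, hp⟩
    -- decompose `p = cons _ p₁`, first step to `a'`
    cases p with
    | nil => exact absurd rfl hab
    | cons hadj p₁ =>
      rename_i w
      obtain rfl : w = a' := (ha w).1 hadj
      -- decompose the reverse of `p₁`: last step from `b'`
      have hp₁ : p₁.IsPath := hp.of_cons
      have ha₁ : a ∉ p₁.support := ((SimpleGraph.Walk.cons_isPath_iff hadj p₁).1 hp).2
      cases hr : p₁.reverse with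
      | nil => exact absurd rfl ha'b
      | cons hadj' r₁ =>
        rename_i w'
        obtain rfl : w' = b' := (hb w').1 hadj'
        have hpr : p₁ = (r₁.reverse).concat hbb' := by
          rw [← SimpleGraph.Walk.reverse_reverse p₁, hr, SimpleGraph.Walk.reverse_cons,
            SimpleGraph.Walk.concat]
        have hq : r₁.reverse.IsPath ∧ a ∉ r₁.reverse.support ∧ b ∉ r₁.reverse.support := by
          rw [hpr] at hp₁ ha₁
          rw [SimpleGraph.Walk.concat_isPath_iff] at hp₁
          rw [SimpleGraph.Walk.support_concat, List.mem_append, not_or] at ha₁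
          exact ⟨hp₁.1, ha₁.1, hp₁.2⟩
        refine ⟨⟨r₁.reverse, hq⟩, Subtype.ext ?_⟩
        simp only [B]
        rw [hpr]
  refine ⟨(Equiv.ofBijective B ⟨hinj, hsurj⟩).symm, fun p => ?_⟩
  conv_lhs => rw [← (Equiv.ofBijective B ⟨hinj, hsurj⟩).apply_symm_apply p]
  exact hB _

/-- A self-avoiding walk passes through pendant (degree `≤ 1`) vertices only at its endpoints:
if every vertex outside `Λ` has at most one neighbour, the interior vertices of a self-avoiding
walk lie in `Λ`. [folklore] -/
theorem mem_of_mem_support_isPath {Λ : Set V}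
    (hΛ : ∀ w ∉ Λ, ∀ y y', G.Adj w y → G.Adj w y' → y = y') {u v : V} {p : G.Walk u v}
    (hp : p.IsPath) {w : V} (hw : w ∈ p.support) (hwu : w ≠ u) (hwv : w ≠ v) : w ∈ Λ := by
  by_contra hwΛ
  induction p with
  | nil => simp at hw; exact hwu hw
  | cons hadj q ih =>
    rename_i x y z
    rw [SimpleGraph.Walk.support_cons, List.mem_cons] at hw
    rcases hw with rfl | hw
    · exact hwu rfl
    · -- `w ∈ q.support`, `w ≠ z`; if `w = y` then its two neighbours `x` and the next vertex differ
      by_cases hwy : w = y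
      · subst hwy
        cases q with
        | nil => exact hwv rfl
        | cons hadj₂ q₂ =>
          rename_i y₂
          have h1 : x = y₂ := hΛ w hwΛ x y₂ hadj.symm hadj₂
          subst h1
          have := ((SimpleGraph.Walk.cons_isPath_iff hadj _).1 hp).2
          simp at this
      · exact ih hp.of_cons hw hwy hwv

end Pendant


/-! ### One-sided comparisons with pendant endpoints -/

section SandwichPendant

variable {Ω : Set ℂ} {δ : ℝ} {a b a' b' : HexVertex}

/-- **Outer bound, pendant endpoints: `Z^{can}(a,b) ≤ x² Z_V({a',a},{b',b})`.**  If the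
endpoints `a ≠ b` are pendant vertices of `Ω_δ` (unique `Ω_δ`-neighbours `a'`, `b'`, `a' ≠ b`)
outside a finite vertex set `V ∋ a', b'` such that every vertex outside `V` has at most one
`Ω_δ`-neighbour, then stripping the two forced end-steps injects the canonical self-avoiding walks
`a → b` into the mid-edge walks `{a',a} → {b',b}` in `V` (vertex count shifted by `2`).
[cite: LawlerSchrammWerner2004SAW, §3.4 ("SAW satisfies restriction")] -/
theorem sum_pow_vertexCount_le_pendant {V : Finset HexVertex} [Fintype (HexDomainSAW Ω δ a b)]
    (hout : ∀ v ∉ (↑V : Set HexVertex), ∀ y y', (hexDomainGraph Ω δ).Adj v y →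
      (hexDomainGraph Ω δ).Adj v y' → y = y')
    (hab : a ≠ b) (haV : a ∉ V) (hbV : b ∉ V) (ha'V : a' ∈ V) (hb'V : b' ∈ V) (ha'b : a' ≠ b)
    (ha : ∀ w, (hexDomainGraph Ω δ).Adj a w ↔ w = a')
    (hb : ∀ w, (hexDomainGraph Ω δ).Adj b w ↔ w = b') {x : ℝ} (hx : 0 ≤ x) :
    ∑ γ : HexDomainSAW Ω δ a b, x ^ γ.vertexCount ≤
      x ^ 2 * ∑ γ : HexMidEdgeSAW V s(a', a) s(b', b), x ^ γ.length := by
  have hne : s(a', a) ≠ s(b', b) := by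
    intro h
    rcases Sym2.eq_iff.1 h with ⟨-, h2⟩ | ⟨h1, -⟩
    · exact hab h2
    · exact ha'b h1
  have hadj : hexGraph.Adj a' a :=
    (embDomainGraph_le hexGraph hexCenter Ω δ ((ha a').2 rfl)).symm
  obtain ⟨e₁, he₁⟩ := exists_equiv_isPath_pendant (G := hexDomainGraph Ω δ) hab ha hb ha'b
  obtain ⟨e₄, he₄⟩ := exists_equiv_isPath_hexMidEdgeSAW_loc (vb := b') ha'V haV hbV hadj hne
  have hsuppV : ∀ q : {q : (hexDomainGraph Ω δ).Walk a' b' // q.IsPath ∧ a ∉ q.support ∧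
      b ∉ q.support}, ∀ w ∈ (q.1.mapLe (embDomainGraph_le hexGraph hexCenter Ω δ)).support,
      w ∈ V := by
    intro q w hw
    rw [SimpleGraph.Walk.support_mapLe_eq_support] at hw
    by_cases hwa' : w = a'
    · rw [hwa']; exact ha'V
    by_cases hwb' : w = b'
    · rw [hwb']; exact hb'V
    exact mem_of_mem_support_isPath hout q.2.1 hw hwa' hwb'
  let ι : HexDomainSAW Ω δ a b → HexMidEdgeSAW V s(a', a) s(b', b) := fun γ =>
    e₄ ⟨(e₁ ⟨γ.walk, γ.isPath⟩).1.mapLe (embDomainGraph_le hexGraph hexCenter Ω δ),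
      (SimpleGraph.Walk.isPath_mapLe _).2 (e₁ ⟨γ.walk, γ.isPath⟩).2.1, hsuppV _⟩
  have hι : ∀ γ : HexDomainSAW Ω δ a b, γ.walk.support = a :: ((ι γ).verts ++ [b]) := fun γ => by
    simp only [ι, he₄, SimpleGraph.Walk.support_mapLe_eq_support]
    exact he₁ ⟨γ.walk, γ.isPath⟩
  have hinj : Function.Injective ι := by
    intro γ₁ γ₂ h
    have h' : γ₁.walk.support = γ₂.walk.support := by rw [hι, hι, h]
    obtain ⟨w₁, hw₁⟩ := γ₁
    obtain ⟨w₂, hw₂⟩ := γ₂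
    obtain rfl : w₁ = w₂ := SimpleGraph.Walk.ext_support h'
    rfl
  have hlen : ∀ γ, γ.vertexCount = (ι γ).length + 2 := fun γ => by
    have h := congrArg List.length (hι γ)
    rw [SimpleGraph.Walk.length_support, List.length_cons, List.length_append,
      List.length_singleton] at h
    rw [HexMidEdgeSAW.length, ← h]
    rfl
  calc ∑ γ : HexDomainSAW Ω δ a b, x ^ γ.vertexCount
      = ∑ γ : HexDomainSAW Ω δ a b, x ^ 2 * x ^ (ι γ).length :=
        Fintype.sum_congr _ _ fun γ => by rw [hlen, pow_add, mul_comm]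
    _ = ∑ γ ∈ Finset.univ.map ⟨ι, hinj⟩, x ^ 2 * x ^ γ.length := by
        rw [Finset.sum_map]; rfl
    _ ≤ ∑ γ : HexMidEdgeSAW V s(a', a) s(b', b), x ^ 2 * x ^ γ.length :=
        Finset.sum_le_sum_of_subset_of_nonneg (Finset.subset_univ _)
          fun γ _ _ => mul_nonneg (pow_nonneg hx _) (pow_nonneg hx _)
    _ = x ^ 2 * ∑ γ : HexMidEdgeSAW V s(a', a) s(b', b), x ^ γ.length := by
        rw [Finset.mul_sum]

/-- **Inner bound, pendant endpoints: `x² Z_Λ({a',a},{b',b}) ≤ Z^{can}(a,b)`.**  If every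
honeycomb edge inside `Λ` is an edge of `Ω_δ`, `a' ∈ Λ`, `a, b ∉ Λ`, `a ≠ b`, and the end-steps
`a ∼ a'`, `b' ∼ b` are edges of `Ω_δ`, then `γ ↦ a :: γ ++ [b]` injects the mid-edge walks
`{a',a} → {b',b}` in `Λ` into the canonical self-avoiding walks `a → b` of `Ω_δ`.
[cite: LawlerSchrammWerner2004SAW, §3.4 ("SAW satisfies restriction")] -/
theorem pendant_sum_pow_length_le {Λ : Finset HexVertex} [Fintype (HexDomainSAW Ω δ a b)]
    (hΛ : ∀ v ∈ Λ, ∀ w ∈ Λ, hexGraph.Adj v w → (hexDomainGraph Ω δ).Adj v w)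
    (hab : a ≠ b) (haΛ : a ∉ Λ) (hbΛ : b ∉ Λ) (ha'Λ : a' ∈ Λ)
    (haa' : (hexDomainGraph Ω δ).Adj a a') (hb'b : (hexDomainGraph Ω δ).Adj b' b)
    (hne : s(a', a) ≠ s(b', b)) {x : ℝ} (hx : 0 ≤ x) :
    x ^ 2 * ∑ γ : HexMidEdgeSAW Λ s(a', a) s(b', b), x ^ γ.length ≤
      ∑ γ : HexDomainSAW Ω δ a b, x ^ γ.vertexCount := by
  have hadj : hexGraph.Adj a' a := (embDomainGraph_le hexGraph hexCenter Ω δ haa').symm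
  obtain ⟨e₂, he₂⟩ := exists_equiv_isPath_of_le_loc (embDomainGraph_le hexGraph hexCenter Ω δ)
    (Λ := (↑Λ : Set HexVertex)) (fun v hv w hw h => hΛ v hv w hw h) a' b'
  obtain ⟨e₄, he₄⟩ := exists_equiv_isPath_hexMidEdgeSAW_loc (vb := b') ha'Λ haΛ hbΛ hadj hne
  -- re-attach the two end-steps
  let ι : HexMidEdgeSAW Λ s(a', a) s(b', b) → HexDomainSAW Ω δ a b := fun γ =>
    ⟨SimpleGraph.Walk.cons haa' ((e₂.symm (e₄.symm γ)).1.concat hb'b), by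
      have hq := (e₂.symm (e₄.symm γ)).2
      refine SimpleGraph.Walk.IsPath.cons (hq.1.concat (fun h => hbΛ (hq.2 b h)) hb'b) ?_
      rw [SimpleGraph.Walk.support_concat, List.mem_append, List.mem_singleton, not_or]
      exact ⟨fun h => haΛ (hq.2 a h), hab⟩⟩
  have hι : ∀ γ, (ι γ).walk.support = a :: (γ.verts ++ [b]) := fun γ => by
    have h4 := he₄ (e₄.symm γ)
    rw [Equiv.apply_symm_apply] at h4
    have h2 := he₂ (e₂.symm (e₄.symm γ))
    rw [Equiv.apply_symm_apply] at h2
    simp only [ι, SimpleGraph.Walk.support_cons, SimpleGraph.Walk.support_concat, h4, h2]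
  have hinj : Function.Injective ι := fun γ₁ γ₂ h => by
    have h' := congrArg (fun γ : HexDomainSAW Ω δ a b => γ.walk.support) h
    simp only [hι, List.cons.injEq, true_and] at h'
    exact HexMidEdgeSAW.ext (List.append_cancel_right h')
  have hlen : ∀ γ, (ι γ).vertexCount = γ.length + 2 := fun γ => by
    have h := congrArg List.length (hι γ)
    rw [SimpleGraph.Walk.length_support, List.length_cons, List.length_append,
      List.length_singleton] at h
    rw [HexMidEdgeSAW.length, ← h]
    rfl
  calc x ^ 2 * ∑ γ : HexMidEdgeSAW Λ s(a', a) s(b', b), x ^ γ.length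
      = ∑ γ : HexMidEdgeSAW Λ s(a', a) s(b', b), x ^ (ι γ).vertexCount := by
        rw [Finset.mul_sum]
        exact Fintype.sum_congr _ _ fun γ => by rw [hlen, pow_add, mul_comm]
    _ = ∑ γ ∈ Finset.univ.map ⟨ι, hinj⟩, x ^ γ.vertexCount := by
        rw [Finset.sum_map]; rfl
    _ ≤ ∑ γ : HexDomainSAW Ω δ a b, x ^ γ.vertexCount :=
        Finset.sum_le_sum_of_subset_of_nonneg (Finset.subset_univ _)
          fun γ _ _ => pow_nonneg hx _

end SandwichPendant

/-! ### Registered form: the pendant sandwich (sub-goal of `stub_canonicalTransfer`) -/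

/-- **Registered sub-goal `stub_canonicalTransfer_pendantSandwich`** (crux item
stmt-CriticalPhenomena-10472, line `floor-ratio-restriction-bootstrap`, stub
`stub_canonicalTransfer`): THE FIXED-SCALE SANDWICH with pendant canonical endpoints.  For finite
vertex sets `Λ ⊆ V` not containing the pendant endpoints `a ≠ b` of `Ω_δ` (unique
`Ω_δ`-neighbours `a' ∈ Λ`, `b' ∈ V`, `a' ≠ b`), such that every honeycomb edge inside `Λ` is an
edge of `Ω_δ` and every vertex outside `V` has at most one `Ω_δ`-neighbour:
`x_c² Z_Λ({a',a},{b',b}) ≤ Σ_{γ : SAW of Ω_δ, a → b} x_c^{#vertices(γ)} ≤ x_c² Z_V({a',a},{b',b})`.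
[cite: LawlerSchrammWerner2004SAW, §3.4 ("SAW satisfies restriction")] -/
theorem stub_canonicalTransfer_pendantSandwich :
    ∀ (Ω : Set ℂ) (δ : ℝ) (Λ V : Finset HexVertex) (a b a' b' : HexVertex)
    [Fintype (HexDomainSAW Ω δ a b)],
    (∀ v ∈ Λ, ∀ w ∈ Λ, hexGraph.Adj v w → (hexDomainGraph Ω δ).Adj v w) →
    (∀ v ∉ (↑V : Set HexVertex), ∀ y y' : HexVertex, (hexDomainGraph Ω δ).Adj v y →
      (hexDomainGraph Ω δ).Adj v y' → y = y') →
    Λ ⊆ V → a ≠ b → a ∉ V → b ∉ V → a' ∈ Λ → b' ∈ V → a' ≠ b →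
    (∀ w : HexVertex, (hexDomainGraph Ω δ).Adj a w ↔ w = a') →
    (∀ w : HexVertex, (hexDomainGraph Ω δ).Adj b w ↔ w = b') →
    hexCriticalFugacity ^ 2 *
          ∑ γ : HexMidEdgeSAW Λ s(a', a) s(b', b), hexCriticalFugacity ^ γ.length ≤
        ∑ γ : HexDomainSAW Ω δ a b, hexCriticalFugacity ^ γ.vertexCount ∧
      ∑ γ : HexDomainSAW Ω δ a b, hexCriticalFugacity ^ γ.vertexCount ≤
        hexCriticalFugacity ^ 2 *
          ∑ γ : HexMidEdgeSAW V s(a', a) s(b', b), hexCriticalFugacity ^ γ.length := by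
  intro Ω δ Λ V a b a' b' _ hΛ hout hΛV hab haV hbV ha'Λ hb'V ha'b ha hb
  have hne : s(a', a) ≠ s(b', b) := by
    intro h
    rcases Sym2.eq_iff.1 h with ⟨-, h2⟩ | ⟨h1, -⟩
    · exact hab h2
    · exact ha'b h1
  exact ⟨pendant_sum_pow_length_le hΛ hab (fun h => haV (hΛV h)) (fun h => hbV (hΛV h)) ha'Λ
      ((ha a').2 rfl) (((hb b').2 rfl).symm) hne hexCriticalFugacity_pos_lt_one.1.le,
    sum_pow_vertexCount_le_pendant hout hab haV hbV (hΛV ha'Λ) hb'V ha'b ha hb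
      hexCriticalFugacity_pos_lt_one.1.le⟩

end Summit.CriticalPhenomena.SAWScalingLimit.Theorems.ObservableToSLE.FloorRatio

end
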